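import Summits.NavierStokesRegularity.NavierStokesRegularity.Theorems.FilamentSkeletonRssSkeletonJ1RSplit
import Summits.NavierStokesRegularity.NavierStokesRegularity.Theorems.FilamentSkeletonRssNormalBlockMatchedL
import Summits.NavierStokesRegularity.NavierStokesRegularity.Theorems.FilamentSkeletonRssClause13RImp
import Summits.NavierStokesRegularity.NavierStokesRegularity.Theorems.FilamentSkeletonRssSkeletonJ1RFrameDefs
import Summits.NavierStokesRegularity.NavierStokesRegularity.Theorems.FilamentSkeletonRssSkeletonJ1RLineDefs
import Summits.NavierStokesRegularity.NavierStokesRegularity.Theorems.FilamentSkeletonRssSkeletonJ1RLiaFrameExists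
import Summits.NavierStokesRegularity.NavierStokesRegularity.Theorems.FilamentSkeletonRssSkeletonJ1RFlatOutput
import Summits.NavierStokesRegularity.NavierStokesRegularity.Theorems.FilamentSkeletonRssSkeletonJ1RReferenceInjectivityOfCore
import Summits.NavierStokesRegularity.NavierStokesRegularity.Theorems.FilamentSkeletonRssSkeletonJ1RLiaDefectB
import Summits.NavierStokesRegularity.NavierStokesRegularity.Theorems.FilamentSkeletonRssSkeletonJ1RReferenceInjectivityOfCoreL1
import Summits.NavierStokesRegularity.NavierStokesRegularity.Theorems.FilamentSkeletonRssSelection1ARcof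

/-!
# Route `FilamentSkeletonRss` · item `SkeletonJ1Rcof` (stmt-NavierStokesRegularity-24202, the COFINAL twin of the ∃-crux `SkeletonJ1R` stmt-23610) ·
# line `streamline_kantorovich_R_cof` — MIRROR of the line of record v7b for 23610

LINE-WRITER seat `linewriter-ns-filamentrss-1-g0` (planner), 2026-08-31.  `SkeletonJ1Rcof` («a skeleton for a COFINAL set of circulations Γ», crux idea
`Cruxes/SkeletonJ1R/Ideas/cofinal-selection.md`) is what the assembly actually consumes (`selection1ARcof_proof`, item 24203 proved) and is implied by the crux of
record through the landed `Theorems.skeletonJ1Rcof_of_skeletonJ1R`.  Consequently EVERY line for 23610 is a line for 24202, and today the only live line is the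
lead's `streamline_kantorovich_R` v7b (sha16 4b067f5f13f71d7e): LIA reference frame (F1, landed) → switched normal defect rate (F2-B, landed) and its collar
derivative rate (F2-d, OPEN) → core pinning on the closed switched region in the collar-C¹ currency (L-core′, OPEN, XL) ⇒ reference injectivity (L′, landed glue)
→ Newton–Kantorovich closing at s = 1 (K-B′, OPEN) → flat output (D, landed) ⇒ the heart `TangentSkeletonNearStraightL`; with 13-R (OPEN, stmt-23612 — its own
registered line `Cruxes/Clause13RNearStraightL/Lines/rate_bordered_split.lean`) and the landed normal block, the split glue `skeletonJ1R_of_children` gives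
`SkeletonJ1R`, and cofinality is one more landed implication.  This file is that composition with the SAME four open stubs BY NAME AND SIGNATURE
(statements imported from `…Theorems.SkeletonJ1RLineDefs`, namespace `…Theorems.SkeletonJ1RFrame`), so that a stub landed `--supports` either item serves both.

HONEST LABEL: no mathematics beyond v7b; the cofinal weakening has NO line of its own yet (its purpose — skipping resonant circulation windows at fixed distance —
is insurance for a WINDOWED failure of K-B′/L-core′; the v7b line is Γ-uniform and does not use it).  The smallest typed statement that would give 24202 a line
of its own is `ConfinementCof`/`CorePinningL1` with `∀ Γ ≥ Γ₂` weakened to `∀ Γ₁ ∃ Γ ≥ Γ₁` (idea card §First lemma) — not filed here (no new items in this seat).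
MODEL rung, NEGATIVE side of a hypothetical blow-up scenario; nothing here bears on Navier–Stokes regularity. [folklore]
-/

set_option linter.dupNamespace false

noncomputable section

namespace Summit.NavierStokesRegularity.NavierStokesRegularity.Cruxes.SkeletonJ1Rcof.StreamlineKantorovichRCof

open Set Function Filter MeasureTheory Real
open Literature.Analysis.FluidPDE
open Summit.NavierStokesRegularity.NavierStokesRegularity.Theses.FilamentSkeletonRss
open Summit.NavierStokesRegularity.NavierStokesRegularity.Theorems.FilamentSkeletonRssSkeletonJ1GSplit
  (NearStraightJ1G StraightDatum straightDatumGP_exists)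
open Summit.NavierStokesRegularity.NavierStokesRegularity.Theorems.FilamentSkeletonRssSkeletonJ1LSplit
  (FlatJ1L TangentSkeletonNearStraightLS route_tangentSkeletonNearStraightL_iff)
open Summit.NavierStokesRegularity.NavierStokesRegularity.Theorems.SkeletonJ1RFrame
open scoped InnerProductSpace Topology BigOperators

/-! ## §1–§3 Vocabulary and stub statements: IMPORTED from `…SkeletonJ1RFrameDefs` / `…SkeletonJ1RLineDefs` (namespace `…Theorems.SkeletonJ1RFrame`) -/

/-! ## §4 The stubs (the ONLY `sorry`s of this file) + the record's 13-R stub BY NAME -/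

/-- STUB F1 · `stub_liaFrameExistsL` · DISCHARGED BY NAME: the LIA reference frame exists at `λ = 1` (landed `…SkeletonJ1RLiaFrameExists`:
IVP + near-straightness bootstrap + skew-line geometry + rates + explicit datum-sliced model).  No `sorry`. -/
theorem stub_liaFrameExistsL : LiaFrameExistsL :=
  Summit.NavierStokesRegularity.NavierStokesRegularity.Theorems.SkeletonJ1RFrame.stub_liaFrameExistsL

/-- STUB F2-B · `stub_liaDefectBL` · DISCHARGED BY NAME (reshape 4, lead g2): the switched normal defect of the LIA reference is
`O((√Γ + |τ|)/√log Γ)` (landed `…SkeletonJ1RLiaDefectB.stub_liaDefectBL`).  No `sorry`. -/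
theorem stub_liaDefectBL : LiaDefectBL :=
  Summit.NavierStokesRegularity.NavierStokesRegularity.Theorems.SkeletonJ1RFrame.stub_liaDefectBL

/-- STUB F2-d · `stub_liaDefectDerivBL` · M–L (reshape 4′): the COLLAR DERIVATIVE RATE of the switched normal defect of the LIA reference,
`ℓ·‖∂_τ swDefect(x) j τ‖ ≤ C_d(√Γ + |τ|)/√(log Γ)` on `ℓ² ≤ ‖x_j τ‖² ≤ 2ℓ²` — the derivative falls on the strand integrals of the landed F2-B chain. -/
theorem stub_liaDefectDerivBL : LiaDefectDerivBL := by
  sorry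

/-- STUB L-core′ · `stub_corePinningL1` · XL · THE HARDEST AND MOST INFORMATIVE (reshape 4′ of L-core): reference injectivity on the closed switched
region `‖x_j τ‖² ≤ 2ℓ²` against a linearised switched defect bounded in the COLLAR-`C¹` norm (`‖Df‖ ≤ L` and `ℓ‖∂_τ Df_j‖ ≤ L` on the collar), Γ-uniform
gain `K(datum, Rb)`; tenure g31's cut: (L-red′) reduction to the in-plane scalar problem with `C¹` forcing, (L-ode′) the uniformly-valid connection across
the simple turning point with one integration by parts on the collar (no resonant denominator), (L-band) the far/band pinning already landed. -/
theorem stub_corePinningL1 : CorePinningL1 := by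
  sorry

/-- STUB L′ · `stub_referenceInjectivityL1` · DISCHARGED from `stub_corePinningL1` by the landed real proof `referenceInjectivityL1_of_core`
(far pinning `…SkeletonJ1RFarPinning` + exit-parameter argument, defect function threaded: `…SkeletonJ1RReferenceInjectivityOfCoreL1`).  No `sorry`
of its own. -/
theorem stub_referenceInjectivityL1 : ReferenceInjectivityL1 :=
  Summit.NavierStokesRegularity.NavierStokesRegularity.Theorems.SkeletonJ1RFrame.referenceInjectivityL1_of_core stub_corePinningL1

/-- STUB K-B′ · `stub_kantorovichClosingBL1` · L–XL · Newton–Kantorovich (`NewtonKantorovich_holds`) for `I − Φ¹` at `s = 1` in the COLLAR-`C¹`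
defect currency, fed by F1, the RATE-B defect F2-B, its collar derivative rate F2-d and L′ (reshape 4′: `KantorovichClosingBL1 = LiaFrameExistsL →
LiaDefectBL → LiaDefectDerivBL → ReferenceInjectivityL1 → FineFixedPointL`). -/
theorem stub_kantorovichClosingBL1 : KantorovichClosingBL1 := by
  sorry

/-- STUB D · `stub_flatOutputL` · DISCHARGED BY NAME (landed `…SkeletonJ1RFlatOutput`, p717964, stub-D hand ns-filament-21221-p1 g17).  No `sorry`. -/
theorem stub_flatOutputL : FlatOutputL :=
  Summit.NavierStokesRegularity.NavierStokesRegularity.Theorems.SkeletonJ1RFrame.stub_flatOutputL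

/-- The record's 13-R stub BY NAME AND SIGNATURE (piece 2 of the split of record, stmt-NavierStokesRegularity-23612; unchanged by this line, shared
with every registered/published line of this crux). -/
theorem stub_clause13R :
    Summit.NavierStokesRegularity.NavierStokesRegularity.Theses.FilamentSkeletonRss.Clause13RNearStraightL := by
  sorry

/-- Piece 3 of the split of record — DISCHARGED BY NAME: `NormalBlockMatchedL` (stmt-23322) is a theorem in the tree (p667604). No `sorry`. -/
theorem normalBlockL_landed :
    Summit.NavierStokesRegularity.NavierStokesRegularity.Theses.FilamentSkeletonRss.NormalBlockMatchedL :=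
  Summit.NavierStokesRegularity.NavierStokesRegularity.Theorems.FilamentSkeletonRssNormalBlockMatchedL.stub_normalBlockL

/-! ## §5 Composition (REAL proofs, no stub constant used until `SkeletonJ1R_of`) -/

/-- The heart's content from the four stub STATEMENTS (modus ponens; recorded so that the seam F1/F2-B/F2-d/L′ ⟶ K-B′ is kernel-visible). -/
theorem fineFixedPointL_of (hF1 : LiaFrameExistsL) (hF2 : LiaDefectBL) (hF2d : LiaDefectDerivBL) (hL : ReferenceInjectivityL1)
    (hK : KantorovichClosingBL1) : FineFixedPointL :=
  hK hF1 hF2 hF2d hL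

/-- COMPOSITION over the five stub STATEMENTS: the frame (F1) at every `Γ ≥ Γ₁`, the Kantorovich fixed point (K-B′, fed by F1, F2-B, F2-d and L′) in that very
frame, booked by (D) at `λ = 1`.  Constants threaded: `Rb₁ := min Rb₁ᴰ (min Rb₁ᶠ Rb₁ᴷ)`, `Γ₂ := max Γ₁ᶠ (max Γ₂ᴷ Γ₃ᴰ)`. -/
theorem tangentSkeletonNearStraightLS_of (hF1 : LiaFrameExistsL) (hF2 : LiaDefectBL) (hF2d : LiaDefectDerivBL) (hL : ReferenceInjectivityL1)
    (hK : KantorovichClosingBL1) (hD : FlatOutputL) : TangentSkeletonNearStraightLS := by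
  intro N δd ρd Λd Rwd θd mw p t γ α s₀ hN hδ hρ hRw hθ hmw hSD hGP
  obtain ⟨δ, ρ, K, Λ, Rw, cg, θ₀, KA, RbD, hδ', hρ', hRw', hcg, hθ₀', hRbD, hKρ, hDfam⟩ :=
    hD N δd ρd Λd Rwd θd mw p t γ α s₀ hN hδ hρ hRw hθ hmw hSD hGP
  obtain ⟨RbF, hRbF, hFfam⟩ := hF1 N δd ρd Λd Rwd θd mw p t γ α s₀ hN hδ hρ hRw hθ hmw hSD hGP
  obtain ⟨RbK, hRbK, hKfam⟩ := (fineFixedPointL_of hF1 hF2 hF2d hL hK) N δd ρd Λd Rwd θd mw p t γ α s₀ hN hδ hρ hRw hθ hmw hSD hGP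
  refine ⟨δ, ρ, K, Λ, Rw, cg, θ₀, KA, min RbD (min RbF RbK), hδ', hρ', hRw', hcg, hθ₀',
    lt_min hRbD (lt_min hRbF hRbK), hKρ, ?_⟩
  intro Rb hRb hRb₁
  have hRbD' : Rb ≤ RbD := le_trans hRb₁ (min_le_left _ _)
  have hRbF' : Rb ≤ RbF := le_trans hRb₁ (le_trans (min_le_right _ _) (min_le_left _ _))
  have hRbK' : Rb ≤ RbK := le_trans hRb₁ (le_trans (min_le_right _ _) (min_le_right _ _))
  obtain ⟨Γ₁, hframe⟩ := hFfam Rb hRb hRbF'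
  obtain ⟨Γ₂, hfix⟩ := hKfam Rb hRb hRbK'
  obtain ⟨Γ₃, hout⟩ := hDfam 1 Rb one_pos hRb hRbD'
  refine ⟨max Γ₁ (max Γ₂ Γ₃), fun Γ hΓ => ?_⟩
  have hΓ₁ : Γ₁ ≤ Γ := le_trans (le_max_left _ _) hΓ
  have hΓ₂ : Γ₂ ≤ Γ := le_trans (le_trans (le_max_left _ _) (le_max_right _ _)) hΓ
  have hΓ₃ : Γ₃ ≤ Γ := le_trans (le_trans (le_max_right _ _) (le_max_right _ _)) hΓ
  obtain ⟨x, M, hx, hxM⟩ := hframe Γ hΓ₁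
  obtain ⟨X, hfine, htan, hreg⟩ := hfix Γ hΓ₂ x M hx hxM
  obtain ⟨w, c, Aa, hflat, hns⟩ := hout Γ hΓ₃ x M hxM X hfine htan hreg
  exact ⟨X, w, c, Aa, hflat, hns⟩

/-- The child of record `TangentSkeletonNearStraightL` (stmt-NavierStokesRegularity-23320, the heart) from the four stub statements — by the landed
certificate `route_tangentSkeletonNearStraightL_iff` (`Iff.rfl`).  Real proof. -/
theorem tangentSkeletonNearStraightL_of_hyps (hF1 : LiaFrameExistsL) (hF2 : LiaDefectBL) (hF2d : LiaDefectDerivBL) (hL : ReferenceInjectivityL1)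
    (hK : KantorovichClosingBL1) (hD : FlatOutputL) : Summit.NavierStokesRegularity.NavierStokesRegularity.Theses.FilamentSkeletonRss.TangentSkeletonNearStraightL :=
  route_tangentSkeletonNearStraightL_iff.mpr (tangentSkeletonNearStraightLS_of hF1 hF2 hF2d hL hK hD)

/-- `SkeletonJ1R` (the crux of record, stmt-23610) from the stubs, exactly as in v7b (`skeletonJ1R_of_children`, p673130) — stated through a local alias so
that the by-name theorem of THIS file is the cofinal one. -/
def RecordGoal : Prop := Summit.NavierStokesRegularity.NavierStokesRegularity.Theses.FilamentSkeletonRss.SkeletonJ1R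

theorem recordGoal_of : RecordGoal :=
  Summit.NavierStokesRegularity.NavierStokesRegularity.Theorems.FilamentSkeletonRssSkeletonJ1RSplit.skeletonJ1R_of_children
    (tangentSkeletonNearStraightL_of_hyps StreamlineKantorovichRCof.stub_liaFrameExistsL StreamlineKantorovichRCof.stub_liaDefectBL stub_liaDefectDerivBL
      stub_referenceInjectivityL1 stub_kantorovichClosingBL1 StreamlineKantorovichRCof.stub_flatOutputL)
    stub_clause13R normalBlockL_landed

/-- **THE SKELETON THEOREM — the item `FilamentSkeletonRss.SkeletonJ1Rcof` (stmt-NavierStokesRegularity-24202) BY NAME**: the v7b composition followed by the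
landed cofinality implication `skeletonJ1Rcof_of_skeletonJ1R`.  Closed modulo the four stub `sorry`s only (F2-d, L-core′, K-B′, 13-R). -/
theorem SkeletonJ1Rcof_of : Summit.NavierStokesRegularity.NavierStokesRegularity.Theses.FilamentSkeletonRss.SkeletonJ1Rcof :=
  Summit.NavierStokesRegularity.NavierStokesRegularity.Theorems.skeletonJ1Rcof_of_skeletonJ1R recordGoal_of

end Summit.NavierStokesRegularity.NavierStokesRegularity.Cruxes.SkeletonJ1Rcof.StreamlineKantorovichRCof

end
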